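import Summits.Ventures.GridStability.Models.Chiang3
import Summits.Ventures.GridStability.Models.RecastAngles

/-!
# CHIANG3 (rung G1.a′): hypothesis-free embedding lemmas

Venture GRIDFUSION, cell `run/shared/lean/pub/gridfusion/`, PARTITION A8 (seat gridfusion-model-1).
Corollaries of `PolynomialiseInfBus.lean` + `RecastAngles.lean` for the instance `Chiang3.data`: the A1
hypotheses are discharged by `angleOf` (exact circle points, `data_circle`), so along EVERY solution of
the two-machine–infinite-bus model the recast coordinates satisfy `dz_k/dt = f_k(z)` with
`f = Chiang3.field`, and the constraints hold identically — inputs (4)–(5) of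
`Lyapunov/CertificateSoundness.lean` for a future G1.a′-roa file. MODELLED «MV-2L+MV-P»; CERTIFIED:
nothing here; no stability claim.
-/

noncomputable section

open Real
open Literature.Computation.Certificates
open Literature.Computation.Certificates.SOS

namespace Summit.Ventures.GridStability.Models

namespace Chiang3

/-- The A1 hypotheses hold for `Chiang3.data` with the angles `angleOf` (`θ₁^*, θ₂^*` of the exact
SEP block; bus angle `0`). -/
theorem data_eqData : data.EqData data.angleOf :=
  data.eqData_angleOf data_circle.1 data_circle.2.1 data_circle.2.2

/-- The inertia entries are nonzero (`M = (1, 1, 1)`). -/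
theorem data_M_ne_zero : ∀ i, data.M i ≠ 0 := by decide +kernel

/-- **Hypothesis-free chain rule for CHIANG3.** Along every solution of the two-machine–infinite-bus
model (`data.IsInfBusSolutionOn δ₀ c s`: bus angle frozen at `δ₀`, bus speed deviation `0`, machines
1, 2 classical with `M = 1`, `D = (2/5, 1/2)`), every recast coordinate
`z_k = embedRel θ^* (c τ) k`, `k = 0..5` (and trivially beyond), satisfies `dz_k/dt = f_k(z)` within `s`,
`f = Chiang3.field`. -/
theorem hasDerivWithinAt_embed {δ₀ : ℝ} {c : ℝ → ClassicalSwing.State 3} {s : Set ℝ}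
    (hc : data.IsInfBusSolutionOn δ₀ c s) {t : ℝ} (ht : t ∈ s) (k : ℕ) :
    HasDerivWithinAt (fun τ => RecastData.embedRel data.angleOf (c τ) k)
      ((field.getD k []).eval (RecastData.embedRel data.angleOf (c t))) s t :=
  data.hasDerivWithinAt_embedInf data_eqData data_M_ne_zero hc ht k

/-- The two recast constraints vanish identically along the embedding (input (5)). -/
theorem eval_constraints (x : ClassicalSwing.State 3) (i : Fin 2) :
    (RecastData.hcon i).eval (RecastData.embedRel data.angleOf x) = 0 :=
  RecastData.eval_hcon_rel (δs := data.angleOf) x i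

end Chiang3

end Summit.Ventures.GridStability.Models
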